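import Summits.BirchSwinnertonDyer.BirchSwinnertonDyer.Theorems.EisensteinPrimesAcTwistDeformationSUR
import Summits.BirchSwinnertonDyer.BirchSwinnertonDyer.Theorems.EisensteinPrimesAcTwistDeformationResidualPair
import Summits.BirchSwinnertonDyer.BirchSwinnertonDyer.Theorems.EisensteinPrimesGreenbergFullAtSelmer
import Literature.NumberTheory.IwasawaTheory.Greenberg2016.LOC2Archimedean
import HarnessLib

/-!
# Greenberg 2016 Prop. 4.1.1 (c) AT the one-variable anticyclotomic twist deformation `𝐃₁ = bigRep κ ρ₀`:
# the Selmer group `S_{𝓛_𝔭}(K, 𝐃₁)` is ALMOST `Λ`-DIVISIBLE (its Pontryagin duals have no non-zero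
# pseudo-null = finite submodules)
# (helper file for crux 2 `GoodLatticeBDPValue`, stmt-BirchSwinnertonDyer-19032, line `halves` v19.1, stub
# `stub_imprimLambda` (KY Thm. 1.4.1 (iii)), V20 road brick (c) «no finite submodules», CHARACTER side, part 1;
# seat `bsd-line-x1-p1-w3` gen 2)

KY's proof of the λ-identity (iii) reads `λ(𝔛^S_?) = d(Sel(M_?)[𝔭]) − d(Sel(M_?)/𝔭)` and needs the
finite parts `#𝔛^S_?[p]` of the Herbrand counts (LEAD g3's `CharDualExactCount.pow_lambdaInvariant_mul_natCard_pTorsion_eq`,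
x2-p2 g5's E-side twin) to VANISH: `𝔛^{Sf}` has no non-zero finite `Λ`-submodule. On the character side the
road memo `Cruxes/GoodLatticeBDPValue/Lines/halves-imprimLambda-road.md` §3 (c) obtains this from
Greenberg 2016 Prop. 4.1.1 (`prop411_selmer_isAlmostDivisible`, PUB, already in `stub_publishedFactsGreenberg`)
applied to the ONE-variable twist deformation `𝐃₁(θ) = ℚ_p/ℤ_p(θ) ⊗ Λ^*(κ⁻¹)` of LEAD g2's road (A), then
transported to `K_∞` by the Shapiro bridge. THIS FILE is the Greenberg half:

* §1 `bigRep_LOC2` — LOC_v⁽²⁾(`𝐃₁`) at every place with LOC_v⁽¹⁾: every Tate dual `T* ≅ Hom(𝐃₁, K̄ˣ)`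
  is free of rank one over `Λ = ℤ_p⟦T⟧` (`AcTwistDeformation.nonempty_linearEquiv_of_isDualPairing` with
  `C = K̄ˣ`), so `T*/(T*)^{G_{K_v}} = T*` is reflexive (`Greenberg2016.loc2_of_loc1_of_free`).
* §2 **`bigRep_fullAtSelmer_isAlmostDivisible`** — Prop. 4.1.1 (c) at `𝐃₁` for the specification
  `𝓛_𝔭 = (⊤ at 𝔭, 0 elsewhere)`: binders of `bigRep_fullAt_SUR` (p622277) with Prop. 2.6.3 replaced by
  Props. 4.1.1 / 4.2.2; every other clause — cofree / RFX / cofinitely generated / `p`-primary (p621294),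
  `h⁰ = 0`, LOC_v⁽¹⁾ on the finite `Σ`, the squeeze `h¹ = 1 ∧ h² = 0`, LEO (p621826), CRK (p622277's
  corank inputs), LOC⁽²⁾ on `Σ` (§1 + `loc2_inl_of_isComplex`), `𝓛_𝔭` stable / almost divisible / (c)
  (k5-c2's `GreenbergFullAtSelmer.fullAtSelmer_isAlmostDivisible_of_facts`) — DISCHARGED;
  `bigRep_fullAtSelmer_eq_bot_of_isPseudoNull`: every pseudo-null `Λ`-submodule of every Pontryagin dual
  of `S_{𝓛_𝔭}(K, 𝐃₁)` is `⊥`.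
* §3 `residualPair_fullAtSelmer_isAlmostDivisible` — the instantiation at `θ ∈ {θsub, θquot}` of a residual
  pair (binders of `prop125_residualPair_unrSelmer_corank_ge` as in w3 g0's `residualPair_fullAt_SUR`,
  p629650; `corank S_{𝓛_𝔭} = 0` from [RH]).

NOT HERE (part 2, for the successor LEAD): the Shapiro transport «`S_{𝓛_𝔭}(K, 𝐃₁)` almost divisible ⟹
the Greenberg–Vatsal dual data `D.X` of `H¹_{𝓕_nr}^{Sf}(K_∞, (F/𝒪)(θ))` have no `p`-torsion», which needs
the Shapiro map `F` of p623461 to be ONTO `unrSelmer^{S₀}` (the converse of p626802's landing) and the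
semilinear duality transport `GreenbergPseudoNullSemilinear.hasNoPseudoNullSubmodule_of_isAlmostDivisible_of_semilinear`.
THEOREMS ONLY; conditional on the PUBLISHED named facts it takes as hypotheses; closes nothing by itself.
References: [Greenberg2016Selmer] Prop. 4.1.1 (c) §4.1 p. 15, Prop. 4.2.2 p. 20, §2.1 p. 6, §4.3 p. 20;
[Greenberg2006] Props. 3.2, 4.1, 4.2, §5 A; [KellerYin2024] §1.4 (arXiv:2402.12781v2 TeX L1162–1181).
-/

set_option autoImplicit false
set_option linter.dupNamespace false

noncomputable section

open scoped Classical
open NumberField IsDedekindDomain Field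
open Literature.NumberTheory.EllipticCurves Literature.NumberTheory.GaloisRepresentations
  Literature.NumberTheory.IwasawaTheory Literature.NumberTheory.IwasawaTheory.Greenberg2016
  Literature.NumberTheory.IwasawaTheory.Greenberg2006
  Summit.BirchSwinnertonDyer.BirchSwinnertonDyer.Theorems.TwistDeformationCofree
  Summit.BirchSwinnertonDyer.BirchSwinnertonDyer.Theorems.GreenbergFullAtSelmer

universe u

namespace Summit.BirchSwinnertonDyer.BirchSwinnertonDyer.Theorems.AcTwistDeformation

section AlmostDivisible

variable {K : Type} [Field K] [NumberField K] (S : Set (HeightOneSpectrum (𝓞 K))) {p : ℕ} [Fact p.Prime]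
  {A : Type} [AddCommGroup A] [Module ℤ_[p] A] [TopologicalSpace A] [DiscreteTopology A]
  [TopologicalSpace (PowerSeries ℤ_[p])] [IsTopologicalRing (PowerSeries ℤ_[p])]
  [IsTopologicalAddGroup (BigRepModule ℤ_[p] p A)]
  [ContinuousSMul (PowerSeries ℤ_[p]) (BigRepModule ℤ_[p] p A)]
  (hS : ∀ v : HeightOneSpectrum (𝓞 K), ((p : ℕ) : 𝓞 K) ∈ v.asIdeal → v ∈ S)
  (κ : ZpExtension K p) (ρ₀ : ContinuousRep (GaloisGroupUnramifiedOutside K S) ℤ_[p] A)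

/-! ## §1 LOC⁽²⁾ for `𝐃₁` -/

omit [IsTopologicalRing (PowerSeries ℤ_[p])] [IsTopologicalAddGroup (BigRepModule ℤ_[p] p A)]
  [ContinuousSMul (PowerSeries ℤ_[p]) (BigRepModule ℤ_[p] p A)] in
/-- **LOC_v⁽²⁾(`𝐃₁`) at a place with LOC_v⁽¹⁾(`𝐃₁`)**: every Tate dual `T* ≅ Hom(𝐃₁, K̄ˣ)` of the
one-variable twist deformation of a corank-one `A` is free of rank one over `Λ = ℤ_p⟦T⟧`, hence
`T*/(T*)^{G_{K_v}} = T*` (LOC⁽¹⁾) is reflexive. [cite: Greenberg2016Selmer, §2.1 p. 6 L1–10, §4.3 p. 20 L23–26]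
[cite: Greenberg2006, p. 342 L5–11] -/
theorem bigRep_LOC2 (hA : ∀ a : A, ∃ k : ℕ, p ^ k • a = 0)
    (jU : A →+ DiscreteGaloisModule.UnitsCarrier K)
    (hinj : ∀ c : ℤ_[p], (∀ a : A, jU (c • a) = 0) → c = 0)
    (hsurj : ∀ φ : A →+ DiscreteGaloisModule.UnitsCarrier K, ∃ c : ℤ_[p], ∀ a : A, φ a = jU (c • a))
    (v : Place K) (h1 : LOC1 S (bigRep (κ.liftUnramifiedOutside S hS) ρ₀) v) :
    LOC2 S (bigRep (κ.liftUnramifiedOutside S hS) ρ₀) v := by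
  refine loc2_of_loc1_of_free h1 fun Y _ _ toDual hY ↦ ?_
  obtain ⟨e⟩ := nonempty_linearEquiv_of_isDualPairing jU hA hinj hsurj hY
  exact ⟨Module.Free.of_equiv e.symm, Module.Finite.equiv e.symm⟩

variable {S}

/-! ## §2 Prop. 4.1.1 (c) at `𝐃₁` -/

/-- **Greenberg 2016 Prop. 4.1.1 (c) AT THE ONE-VARIABLE TWIST DEFORMATION: `S_{𝓛_𝔭}(K, 𝐃₁)` is almost
`Λ`-divisible.** `𝐃₁ = bigRep κ ρ₀` for ANY `A ≃ ℚ_p/ℤ_p` on which `G_{K,S}` acts by a character, over a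
`ℤ_p`-extension `κ` of an IMAGINARY QUADRATIC `K` with `p = 𝔭𝔭̄` split and no place of `S` splitting
completely in `K_∞`; granted SIX published facts by name (Greenberg 2016 Props. 4.1.1, 4.2.2; Greenberg 2006
Props. 4.1, 4.2, §5 A, 3.2) and `corank_Λ S_{𝓛_𝔭}(K, 𝐃₁) = 0` with `S_{𝓛_𝔭}` cofinitely generated.
[cite: Greenberg2016Selmer, Prop. 4.1.1 (c) (§4.1 p. 15 L21–32), Prop. 4.2.2 (§4.2 p. 20 L4–8), §4.3 p. 20 L19–30]
[cite: Greenberg2006, Prop. 3.2 p. 358, Props. 4.1–4.2 (§4 A pp. 367–368), §5 A (p. 373)] -/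
theorem bigRep_fullAtSelmer_isAlmostDivisible (h411 : prop411_selmer_isAlmostDivisible)
    (h422 : prop422_localCohomology_isAlmostDivisible) (h41 : prop41_globalEulerPoincareCorank)
    (h42 : prop42_localEulerPoincareCorank) (h5A : sec5A_localH2_subsingleton_of_LOC1)
    (h32 : prop32_cohomology_isCofinitelyGenerated)
    (hSf : S.Finite) (hK : IsImaginaryQuadratic K) (e : A ≃ₗ[ℤ_[p]] QpModZp p)
    (hscalar : ∀ g : GaloisGroupUnramifiedOutside K S, ∃ t : ℤ_[p]ˣ, ∀ a : A, ρ₀ g a = (t : ℤ_[p]) • a)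
    (hsup : ∀ v : HeightOneSpectrum (𝓞 K), v ∈ S →
      ∃ σ : absoluteGaloisGroup (Place.Completion (Sum.inr v : Place K)),
        κ (absGaloisRestrict K _ σ) ≠ 1)
    {𝔭 𝔭bar : HeightOneSpectrum (𝓞 K)} (hne : 𝔭bar ≠ 𝔭)
    (hp𝔭 : ((p : ℕ) : 𝓞 K) ∈ 𝔭.asIdeal) (hp𝔭bar : ((p : ℕ) : 𝓞 K) ∈ 𝔭bar.asIdeal)
    (hSel : HasCorank (PowerSeries ℤ_[p])
      (fullAtSpecification S (bigRep (κ.liftUnramifiedOutside S hS) ρ₀) (Sum.inr 𝔭)).selmer 0)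
    (hSelfg : IsCofinitelyGenerated (PowerSeries ℤ_[p])
      (fullAtSpecification S (bigRep (κ.liftUnramifiedOutside S hS) ρ₀) (Sum.inr 𝔭)).selmer) :
    IsAlmostDivisible (PowerSeries ℤ_[p])
      (fullAtSpecification S (bigRep (κ.liftUnramifiedOutside S hS) ρ₀) (Sum.inr 𝔭)).selmer := by
  set ρ := bigRep (κ.liftUnramifiedOutside S hS) ρ₀ with hρ
  -- standing clauses of the arena at `Λ = R = ℤ_p⟦T⟧`
  have hΛ := nonempty_iwasawaAlgebra_ringEquiv_mvPowerSeries p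
  have hcpl := isAdicComplete_maximalIdeal_iwasawaAlgebra p
  have hres := finite_residueField_iwasawaAlgebra p
  have hchar := charP_residueField_iwasawaAlgebra p
  have hinjΛ : Function.Injective (algebraMap (PowerSeries ℤ_[p]) (PowerSeries ℤ_[p])) :=
    fun a b h ↦ by simpa using h
  have hfin : Module.Finite (PowerSeries ℤ_[p]) (PowerSeries ℤ_[p]) := inferInstance
  have hlin : ∀ (g : GaloisGroupUnramifiedOutside K S) (r : PowerSeries ℤ_[p])
      (d : BigRepModule ℤ_[p] p A), ρ g (r • d) = r • ρ g d := fun g r d ↦ map_smul (ρ g) r d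
  -- the instance data from ONE `e : A ≃ₗ[ℤ_p] ℚ_p/ℤ_p`
  obtain ⟨hA, jQ, -, hinjQ, hsurjQ⟩ := QpModZp.exists_character_hinj_hsurj_of_linearEquiv e
  obtain ⟨jU, -, hinjU, hsurjU⟩ := QpModZp.exists_unitsCarrier_hinj_hsurj_of_linearEquiv K e
  have hcyc : ∀ (v : Place K) (σ : absoluteGaloisGroup v.Completion), ∃ u : ℤ_[p], ∀ a : A,
      DiscreteGaloisModule.units K (absGaloisRestrict K v.Completion σ) (jU a) = jU (u • a) :=
    fun v σ ↦ QpModZp.exists_units_apply_eq_smul K jU hsurjU _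
  -- `𝐃₁`: divisible, cofree of corank one, cofinitely generated, `p`-primary
  have hT := isCofree_bigRepModule hA jQ hinjQ hsurjQ
  have hcf := isCofinitelyGenerated_bigRepModule hA jQ hinjQ hsurjQ
  have hm := hasCorank_one_bigRepModule hA jQ hinjQ hsurjQ
  have hpD : ∀ d : BigRepModule ℤ_[p] p A, ∃ n : ℕ, (p ^ n : ℤ) • d = 0 := exists_zpow_smul_eq_zero
  -- `K` imaginary quadratic, `p` split
  haveI := hK.2
  have hKc : ∀ w : InfinitePlace K, w.IsComplex := IsTotallyComplex.isComplex
  have hr₂ := nrComplexPlaces_eq_one_of_isImaginaryQuadratic hK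
  have hdeg : 𝔭bar.asIdeal.ramificationIdx ℤ * 𝔭bar.asIdeal.inertiaDeg ℤ = 1 :=
    (ncard_primesOver_eq_two_and_deg_one_of_ne hK.1 hp𝔭 hp𝔭bar hne).2 hp𝔭bar
  have hSp : ∀ v : HeightOneSpectrum (𝓞 K), v ∈ S → ((p : ℕ) : 𝓞 K) ∈ v.asIdeal →
      v = 𝔭 ∨ v = 𝔭bar := fun v _ hv ↦ eq_or_eq_of_natCast_mem_of_ne hK.1 hp𝔭 hp𝔭bar hne hv
  -- local conditions at the finite places of `Σ` from the `σ`-supply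
  have hLOC1fin : ∀ v : HeightOneSpectrum (𝓞 K), v ∈ S → LOC1 S ρ (Sum.inr v) := fun v hv ↦ by
    obtain ⟨σ, hσ⟩ := hsup v hv
    obtain ⟨t, ht⟩ := hscalar (localToUnramified S (Sum.inr v) σ)
    obtain ⟨u, hu⟩ := hcyc (Sum.inr v) σ
    exact bigRep_LOC1 S hS κ ρ₀ hA jU hinjU hsurjU (Sum.inr v) σ t ht hu hσ
  have h0loc : ∀ v : HeightOneSpectrum (𝓞 K), v ∈ S →
      HasCorank (PowerSeries ℤ_[p]) ((localRep S ρ (Sum.inr v)).H 0) 0 := fun v hv ↦ by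
    obtain ⟨σ, hσ⟩ := hsup v hv
    exact hasCorank_localH0_bigRep_zero S hS κ ρ₀ hscalar (Sum.inr v) hσ
  have h2loc : ∀ v : HeightOneSpectrum (𝓞 K), v ∈ S →
      HasCorank (PowerSeries ℤ_[p]) ((localRep S ρ (Sum.inr v)).H 2) 0 := fun v hv ↦
    hasCorank_localH2_zero_of_sec5A ρ h5A hSf hS hΛ hpD hcf (hLOC1fin v hv)
  have hcfgloc : ∀ v : Place K, InSigma S v → IsCofinitelyGenerated (PowerSeries ℤ_[p])
      ((localRep S ρ v).H 1) := fun v _ ↦ h32.local hSf hS hΛ ρ hpD hcf v 1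
  -- global `h⁰ = 0`: a class with `κ ≠ 0` exists (`κ` is onto)
  have h0 : HasCorank (PowerSeries ℤ_[p]) (ρ.H 0) 0 := by
    obtain ⟨g, hg⟩ := κ.liftUnramifiedOutside_surjective S hS (Multiplicative.ofAdd 1)
    refine hasCorank_H0_bigRep_zero S hS κ ρ₀ hscalar (g := g) ?_
    rw [hg]
    exact fun h ↦ one_ne_zero (Multiplicative.ofAdd.injective (h.trans ofAdd_zero.symm))
  -- `corank Q = 1`, `Q` cofinitely generated
  have hη'1 : HasCorank (PowerSeries ℤ_[p]) ((localRep S ρ (Sum.inr 𝔭bar)).H 1) 1 :=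
    hasCorank_localH1_of_prop42_degree_one ρ h42 hSf hS hΛ hpD hcf hp𝔭bar hdeg hm
      (h0loc 𝔭bar (hS 𝔭bar hp𝔭bar)) (h2loc 𝔭bar (hS 𝔭bar hp𝔭bar))
  have hcot : ∀ v : Place K, InSigma S v → v ≠ Sum.inr 𝔭 → v ≠ Sum.inr 𝔭bar →
      IsCotorsion (PowerSeries ℤ_[p]) ((localRep S ρ v).H 1) := by
    rintro (w | v) hv h1 h2'
    · exact isCotorsion_localH1_inl_of_isComplex S ρ (hKc w)
    · have hvS : v ∈ S := (inSigma_inr_iff S v).mp hv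
      have hv𝔭 : v ≠ 𝔭 := fun h ↦ h1 (by rw [h])
      have hv𝔭bar : v ≠ 𝔭bar := fun h ↦ h2' (by rw [h])
      have hvp : ((p : ℕ) : 𝓞 K) ∉ v.asIdeal := fun h ↦ by
        rcases hSp v hvS h with h' | h'
        · exact hv𝔭 h'
        · exact hv𝔭bar h'
      exact isCotorsion_localH1_of_prop42 ρ h42 hSf hS hΛ hpD hcf hvp hm (h0loc v hvS) (h2loc v hvS)
        (hcfgloc (Sum.inr v) hv)
  have hQ : HasCorank (PowerSeries ℤ_[p]) (fullAtSpecification S ρ (Sum.inr 𝔭)).QGlobal 1 :=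
    hasCorank_QGlobal_fullAt_one hSf (hS 𝔭bar hp𝔭bar) hne hη'1 hcot
  have hQfg : IsCofinitelyGenerated (PowerSeries ℤ_[p]) (fullAtSpecification S ρ (Sum.inr 𝔭)).QGlobal :=
    isCofinitelyGenerated_QGlobal_fullAt hSf 𝔭 hcfgloc
  -- the squeeze: `h¹ = 1`, `h² = 0`; LEO; CRK
  obtain ⟨hH1, hH2⟩ := hasCorank_H1_one_and_H2_zero ρ h41 hSf hS hKc hr₂ hΛ hpD hcf hm h0
    (fullAtSpecification S ρ (Sum.inr 𝔭)) hSel hSelfg hQ hQfg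
  have hLEO : LEO S ρ := leo_of_hasCorank_H2_zero ρ h32 hSf hS hΛ hpD hcf hH2
  have hCRK : (fullAtSpecification S ρ (Sum.inr 𝔭)).CRK :=
    CRK_of_hasCorank _ (s₀ := 0) (q₀ := 1) (by simpa using hH1) hSel hQ
  -- RFX and LOC⁽²⁾ on all of `Σ`
  have hRFX := rfx_bigRepModule hA jQ hinjQ hsurjQ
  have hLOC2 : ∀ v : Place K, InSigma S v → LOC2 S ρ v := by
    rintro (w | v) hv
    · exact loc2_inl_of_isComplex S ρ w (hKc w)
    · exact bigRep_LOC2 S hS κ ρ₀ hA jU hinjU hsurjU (Sum.inr v)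
        (hLOC1fin v ((inSigma_inr_iff S v).mp hv))
  -- Prop. 4.1.1 (c)
  exact fullAtSelmer_isAlmostDivisible_of_facts h411 h422 h5A hSf hS hΛ hinjΛ hfin hcpl hres hchar
    hlin hT hcf hpD hRFX hLEO hLOC2 (hS 𝔭 hp𝔭) (hLOC1fin 𝔭 (hS 𝔭 hp𝔭)) hCRK

end AlmostDivisible

/-! ## §3 The instantiation at a character of the residual pair ([RH] ⇒ corank 0) -/

section Model

open Literature.NumberTheory.EllipticCurves.GreenbergSelmer Literature.NumberTheory.EllipticCurves.GreenbergVatsal2000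
  Literature.NumberTheory.EllipticCurves.KellerYin2024
  Summit.BirchSwinnertonDyer.BirchSwinnertonDyer.Theorems.AcTwistDeformationResidualPair

variable {K : Type} [Field K] [NumberField K] {p : ℕ} [Fact p.Prime]
  [DiscreteTopology (QpModZp p)]
  [TopologicalSpace (PowerSeries ℤ_[p])] [IsTopologicalRing (PowerSeries ℤ_[p])]
  [IsTopologicalAddGroup (BigRepModule ℤ_[p] p (QpModZp p))]
  [ContinuousSMul (PowerSeries ℤ_[p]) (BigRepModule ℤ_[p] p (QpModZp p))]

/-- **`S_{𝓛_v}(K, 𝐃₁(θ))` IS ALMOST DIVISIBLE, FROM THE SIX GREENBERG FACTS + [RH], BY NAME** — Greenberg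
2016 Prop. 4.1.1 (c) at Keller–Yin's datum: `K` imaginary quadratic, `2 < p = v v̄` split, (Heeg) for `N`,
`κ` anticyclotomic with topological generator `γ`, `θ : Γ_K → GL₁(𝒪)` with `N_S ≤ ker (unitChar θ)` for a
FINITE `S` with `S_p ⊆ S ⊆ S_p ∪ {w ∣ N}`, [RH] as typed in the line; model
`𝐃₁(θ) = bigRep κ (characterRepUnramified S θ h)` on `A = ℚ_p/ℤ_p` (twin of `fullAt_SUR_of_RH`, p629650).
[cite: Greenberg2016Selmer, Prop. 4.1.1 (c) (§4.1 p. 15 L21–32)] [cite: KellerYin2024, §1.4 (arXiv:2402.12781v2 TeX L1162–1181)] -/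
theorem fullAtSelmer_isAlmostDivisible_of_RH (h411 : prop411_selmer_isAlmostDivisible)
    (h422 : prop422_localCohomology_isAlmostDivisible) (h41 : prop41_globalEulerPoincareCorank)
    (h42 : prop42_localEulerPoincareCorank) (h5A : sec5A_localH2_subsingleton_of_LOC1)
    (h32 : prop32_cohomology_isCofinitelyGenerated)
    (hK : IsImaginaryQuadratic K) (hp2 : 2 < p) {N : ℕ} (hH : SatisfiesHeegnerHypothesis N K)
    (κ : ZpExtension K p) (hκ : κ.IsAnticyclotomic)
    {γ : absoluteGaloisGroup K} (hγ : κ.IsTopGenerator γ) {v vbar : HeightOneSpectrum (𝓞 K)}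
    (hv : ((p : ℕ) : 𝓞 K) ∈ v.asIdeal) (hvbar : ((p : ℕ) : 𝓞 K) ∈ vbar.asIdeal) (hne : vbar ≠ v)
    (θ : FramedGaloisRep K (padicCoeffIntegers (∅ : Set (PadicAlgCl p))) 1)
    (S : Set (HeightOneSpectrum (𝓞 K))) (hSfin : S.Finite)
    (hSN : ∀ w ∈ S, ((p : ℕ) : 𝓞 K) ∈ w.asIdeal ∨ ((N : ℤ) : 𝓞 K) ∈ w.asIdeal)
    (hS : ∀ w : HeightOneSpectrum (𝓞 K), ((p : ℕ) : 𝓞 K) ∈ w.asIdeal → w ∈ S)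
    (h : ramificationSubgroup K S ≤ (unitChar θ).toMonoidHom.ker)
    (hRH : ∀ D : DatumDualData κ γ (charModule (∅ : Set (PadicAlgCl p)) θ)
        (Castella2018.AcSelmer.bdpData (charModule (∅ : Set (PadicAlgCl p)) θ) p vbar)
        (∅ : Set (HeightOneSpectrum (𝓞 K))),
      Module.Finite (IwasawaAlgebra p) D.X ∧ Module.IsTorsion (IwasawaAlgebra p) D.X ∧
        muInvariant p D.X = 0) :
    IsAlmostDivisible (PowerSeries ℤ_[p])
      (fullAtSpecification S (bigRep (κ.liftUnramifiedOutside S hS) (characterRepUnramified S θ h))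
        (Sum.inr v)).selmer := by
  obtain ⟨hSel, hSelfg⟩ := hasCorank_fullAtSelmer_zero_of_RH hK κ hγ hv hvbar hne θ S hS h hRH
  exact bigRep_fullAtSelmer_isAlmostDivisible hS κ (characterRepUnramified S θ h) h411 h422 h41 h42 h5A
    h32 hSfin hK (LinearEquiv.refl ℤ_[p] (QpModZp p)) (characterRepUnramified_hscalar S θ h)
    (fun w hw ↦ exists_local_apply_ne_one_of_mem_or hK hp2 hH κ hκ w (hSN w hw)) hne hv hvbar
    hSel hSelfg

/-- **`S_{𝓛_v}(K, 𝐃₁(θ))` is almost divisible AT THE VERBATIM BINDERS of the line's [RH] / residual-pair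
data** (`W/ℚ`, `K` imaginary quadratic with (Heeg) for `N_E`, `v` read through `ι : K →+* ℚ_p`, `v̄ ≠ v`,
`κ` anticyclotomic with `γ` a topological generator as a `Fact`, `Sf` the places over `N_E`, [RH]) for
`S = {v, v̄} ∪ Sf` and ANY `θ` with `N_S ≤ ker (unitChar θ)` (for `θ ∈ {θsub, θquot}`:
`ramificationSubgroup_le_ker_unitChar_of_residualPair`) — twin of `residualPair_fullAt_SUR` (p629650):
every Pontryagin dual of `S_{𝓛_v}(K, 𝐃₁(θ))` has no non-zero pseudo-null (`=` finite, `Λ = ℤ_p⟦T⟧`)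
submodule. The Shapiro transport to the dual data of `H¹_{𝓕_nr}^{Sf}(K_∞, (F/𝒪)(θ))` is NOT in this file.
[cite: Greenberg2016Selmer, Prop. 4.1.1 (c) (§4.1 p. 15 L21–32)] [cite: KellerYin2024, §1.4 (arXiv:2402.12781v2 TeX L1162–1181)] -/
theorem residualPair_fullAtSelmer_isAlmostDivisible (h411 : prop411_selmer_isAlmostDivisible)
    (h422 : prop422_localCohomology_isAlmostDivisible) (h41 : prop41_globalEulerPoincareCorank)
    (h42 : prop42_localEulerPoincareCorank) (h5A : sec5A_localH2_subsingleton_of_LOC1)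
    (h32 : prop32_cohomology_isCofinitelyGenerated)
    (W : WeierstrassCurve ℚ) (hp2 : 2 < p) (hK : IsImaginaryQuadratic K)
    (hH : SatisfiesHeegnerHypothesis (W.conductorNorm ℤ) K)
    {ι : K →+* ℚ_[p]} {v vbar : HeightOneSpectrum (𝓞 K)}
    (hvι : ∀ x : 𝓞 K, x ∈ v.asIdeal ↔ ‖ι (x : K)‖ < 1)
    (hvbar : ((p : ℕ) : 𝓞 K) ∈ vbar.asIdeal) (hne : vbar ≠ v)
    (κ : ZpExtension K p) (hκ : κ.IsAnticyclotomic) (γ : absoluteGaloisGroup K)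
    [Fact (κ.IsTopGenerator γ)] (Sf : Finset (HeightOneSpectrum (𝓞 K)))
    (hSf : ∀ w : HeightOneSpectrum (𝓞 K), w ∈ Sf ↔ ((W.conductorNorm ℤ : ℤ) : 𝓞 K) ∈ w.asIdeal)
    (θ : FramedGaloisRep K (padicCoeffIntegers (∅ : Set (PadicAlgCl p))) 1)
    (hRH : ∀ D : DatumDualData κ γ (charModule (∅ : Set (PadicAlgCl p)) θ)
        (Castella2018.AcSelmer.bdpData (charModule (∅ : Set (PadicAlgCl p)) θ) p vbar)
        (∅ : Set (HeightOneSpectrum (𝓞 K))),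
      Module.Finite (IwasawaAlgebra p) D.X ∧ Module.IsTorsion (IwasawaAlgebra p) D.X ∧
        muInvariant p D.X = 0)
    (hS : ∀ w : HeightOneSpectrum (𝓞 K), ((p : ℕ) : 𝓞 K) ∈ w.asIdeal →
      w ∈ (↑(insert v (insert vbar Sf)) : Set (HeightOneSpectrum (𝓞 K))))
    (h : ramificationSubgroup K (↑(insert v (insert vbar Sf)) : Set (HeightOneSpectrum (𝓞 K))) ≤
      (unitChar θ).toMonoidHom.ker) :
    IsAlmostDivisible (PowerSeries ℤ_[p])
      (fullAtSpecification (↑(insert v (insert vbar Sf)) : Set (HeightOneSpectrum (𝓞 K)))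
        (bigRep (κ.liftUnramifiedOutside _ hS) (characterRepUnramified _ θ h)) (Sum.inr v)).selmer :=
  fullAtSelmer_isAlmostDivisible_of_RH h411 h422 h41 h42 h5A h32 hK hp2 hH κ hκ
    (Fact.out : κ.IsTopGenerator γ) (IwasawaTwoVariable.natCast_mem_asIdeal_of_norm_iff hvι) hvbar hne θ _
    (Finset.finite_toSet _)
    (fun w hw ↦ natCast_mem_or_intCast_mem_of_mem_insert_insert
      (IwasawaTwoVariable.natCast_mem_asIdeal_of_norm_iff hvι) hvbar Sf hSf w hw) hS h hRH

end Model


end Summit.BirchSwinnertonDyer.BirchSwinnertonDyer.Theorems.AcTwistDeformation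

end
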